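import Literature.NumberTheory.Rogawski1990.CartanObstructionIndicator
import Literature.NumberTheory.Rogawski1990.CartanObstructionGlobal
import Literature.NumberTheory.Rogawski1990.SingularObstructionIndicator
import Literature.LinearAlgebra.Matrix.AdjoinSingletonSimpleFactors
import HarnessLib

/-!
# Kottwitz's obstruction at a DEGREE-ONE factor of the Cartan algebra, READ ON THE EIGENVECTOR:
# `(obs p)_𝔪 = 0 ⟺ ⟨g(v₀ ⊗ 1), g(v₀ ⊗ 1)⟩_{H ⊗ 1}` is «global × norm» `⟺ [W]_{L⁺, θ} = 0`
# (Rogawski 1990, §3.5 Prop. 3.5.2 (c) p. 29, §3.3 (3.3.1) p. 22, §4.3 (4.3.3) p. 44; Kottwitz 1986 §9; Cassels–Fröhlich VII §7)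

Topic `NumberTheory/Rogawski1990`; namespace `Literature.NumberTheory.Rogawski1990`; **THEOREMS ONLY** (no definition, no named fact, no instance, no
notation, no `sorry`).  Cell `pub/hodgecm-mathlib`, ENGINE T1 (crux H413 = `stmt-HodgeConjecture-24833`), T6 #72-side node **N5** «(4.3.3) `GlobalKappaFormula` for
`cartanObs`» (desk TABLE #3 row (7), F0P3a-p04 (g8)): the κ-CORE — the obstruction coordinate that the pinned character `e(𝒪H)` of ★ `GlobalTransferWithCartanKappaFormula`
reads (`e(𝒪H)(ε) = (−1)^{ε(s 𝒪H)}`, `s 𝒪H` = the degree-one τ-stable factor `𝔪 ∋ γ₀ − u`, `u = sndVal 𝒪H` the `U(Φ₁)`-coordinate) identified with the quadratic Artin symbol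
of `L ∕ L⁺` at an EXPLICIT idèle: the `H`-value of the `u`-eigenvector of the matching adèle.  Regular-road twin of ★ `SingularObstructionIndicator`
(`singularObs_eq_quadraticArtinIndicator`), one τ-stable factor of degree one at a time.  HC_CM is proved only modulo the printed citations until rung 0 closes.

THE MATHEMATICS.  `γ₀ ∈ U(H)(L⁺)` regular, `B = L[γ₀]`, `τ = ⋆|_B`, `X = X_p ∈ (𝔸_{L⁺} ⊗_{L⁺} B)ˣ` the τ-fixed adelic Cartan class of `p ∈ 𝒞′_𝐀(γ₀)` (★ `adelicCartanRepr`,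
`Ψ X = x_g = (H⊗1)⁻¹ ᵗ(cg)(H⊗1) g`).  A τ-stable maximal ideal `𝔪` with `γ₀ − u ∈ 𝔪` (`u ∈ L`; then `u·cu = 1`, §3) has `B ∕ 𝔪 = L`, evaluation character
`π_u : B → L`, `γ₀ ↦ u`, with `π_u ∘ τ = c ∘ π_u`; for `γ₀ v₀ = u v₀` every `b ∈ B` acts on `v₀` by `π_u(b)`, so `x_g (v₀ ⊗ 1) = ξ · (v₀ ⊗ 1)` with
`ξ = e((1 ⊗ π_u) X) ∈ 𝔸_L` (`e : 𝔸_{L⁺} ⊗ L ≅ 𝔸_L`, Cassels–Fröhlich (19.1)), whence **`⟨g(v₀⊗1), g(v₀⊗1)⟩_{H⊗1} = ξ · ⟨v₀, v₀⟩_H`** (§5) with `⟨v₀, v₀⟩_H ∈ L⁺ˣ`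
(§1: at a SIMPLE unitary eigenvalue the eigenvector is not `H`-isotropic — `ᵗ(cv₀)H` is a left `u`-eigenvector and pairs non-trivially with `v₀`).  By [Prop. 3.5.2 (c)]
the `𝔪`-coordinate of `obs p` vanishes iff `ξ ∈ L⁺ˣ · N(𝔸_Lˣ)` (★ `IsPrincipalNormAt` ↔ ★ `IsPrincipalAdelicNorm` through A-p14's factor calculus ★
`adeleRingTensorAlgEquiv_map_tmul_mul_mul_map` ∕ ★ `exists_repr_of_adeleRingTensorAlgEquiv_map_eq` at `τ_C := c`), a condition insensitive to `L⁺ˣ` and to the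
conjugator (`g′ = g t`, `t (v₀⊗1) = λ(v₀⊗1)`, `λ ∈ 𝔸_Lˣ`); on the descended idèle `W ∈ 𝕀_{L⁺}` (`con W = ⟨g(v₀⊗1), g(v₀⊗1)⟩`) it reads `[W]_{L⁺,θ} = 0`
(★ `isPrincipalAdelicNorm_iff_mem_sup`, ★ O'Meara 65:2 `range_ideleRelNorm_maximalRealSubfield_eq`).

WHAT IS PROVED.
* §1 (any field): `aeval_mulVec_of_mulVec_eq_smul`, `vecMul_aeval_of_vecMul_eq_smul` (polynomials on eigenvectors), `exists_eq_smul_of_mulVec_eq_smul` (the eigenspace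
  of a simple eigenvalue is a line; Mathlib `LinearMap.finrank_eigenspace_le`), **`hermForm_self_ne_zero_of_mulVec_eq_smul`**.
* §3 (CM letters): `exists_mulVec_eq_smul_of_matrixGen_sub_algebraMap_mem` (eigenvector of a degree-one factor), `mul_cmConj_eq_one_of_matrixGen_sub_algebraMap_mem`
  (`u·cu = 1` from τ-stability), `exists_algHom_ker_eq_of_matrixGen_sub_algebraMap_mem` (`π_u` exists), `coe_mulVec_eq_smul_of_ker` (`b v₀ = π_u(b) v₀`),
  `apply_cartanInvolutionCM_eq_cmConj` (`π_u ∘ τ = c ∘ π_u`).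
* §4: `adelicCartanGlue_mulVec_eq_smul` (`Ψ X (v₀⊗1) = e((1⊗π_u)X)(v₀⊗1)`), `exists_isUnit_mulVec_eq_smul_of_commute` (the commutant acts on the eigenline by units).
* §5: **`MatchingAdeleG₂.cartanObsFun_eq_zero_iff_isPrincipalAdelicNorm_map`** (factor-image form), `hermForm_adelicConjugator_mulVec_eq`,
  `exists_hermForm_mulVec_eq_adeleConj_mul_mul`, **`MatchingAdeleG₂.cartanObsFun_eq_zero_iff_isPrincipalAdelicNorm_hermForm`** (eigenvector form, ANY conjugator).
* §6: `MatchingAdeleG₂.exists_ideleBaseChange_eq_hermForm` (descent), **`MatchingAdeleG₂.cartanObsFun_eq_quadraticArtinIndicator_hermForm`** (`(obs p)_𝔪 = [W]_{L⁺,θ}`),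
  `…_eq_zero_iff_exists_ideleRelNorm_hermForm`, `…_eq_zero_iff_mem_sup_normIdeles_hermForm` (placewise), `neg_one_pow_cartanObsFun_eq_neg_one_pow_quadraticArtinIndicator`.
Consumer (N5 assembly): `[W] = Σ_v (W_v, θ)_v` against `∏ᶠ_v finKappaAt · ∏_w archKappaSignAt` of ★ `finExplicitCollection` ∕ ★ `archCanonicalDelta` (the local step «a
non-zero column of `P_v = χ_g(p_v)` is `λ_v · (g v₀)_v`» is `exists_eq_smul_of_mulVec_eq_smul` over `L_w`).

## References
* [Rogawski1990] J. D. Rogawski, *Automorphic Representations of Unitary Groups in Three Variables*, Ann. of Math. Stud. 123 (1990), §3.3 (3.3.1), Prop. 3.3.1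
  p. 22; §3.5 Prop. 3.5.2 (c) p. 29; §3.6 p. 31; §3.8 Prop. 3.8.1 (d) p. 37; §4.3 (4.3.3) p. 44; §5.4 (5.4.5) p. 73; §14.6 p. 242.
* [Kottwitz1986] R. E. Kottwitz, *Stable trace formula: elliptic singular terms*, Math. Ann. 275 (1986), §9.
* [CasselsFrohlichANT1967] Cassels–Fröhlich (eds.), *Algebraic Number Theory* (1967), Ch. II §19 (19.1); Ch. VII §5.1 (B), §7.1, §7.3 (a).
* [Omeara1963] O. T. O'Meara, *Introduction to Quadratic Forms* (1963), §65A Example 65:2.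
-/

set_option autoImplicit false

noncomputable section

open NumberField IsDedekindDomain Polynomial
open scoped TensorProduct Matrix MatrixGroups

namespace Literature.NumberTheory.Rogawski1990

open Literature.NumberTheory.Automorphic Literature.NumberTheory.GaloisRepresentations Literature.LinearAlgebra.Matrix
open Literature.NumberTheory.AdelicBaseChange
open Literature.AlgebraicGeometry.ShimuraVarieties (unitaryGroup mem_unitaryGroup_iff hermForm)

/-! ## §1 Linear algebra over a field: polynomials on eigenvectors; the `H`-value of an eigenvector at a simple unitary eigenvalue -/

section Field

variable {K : Type*} [Field K] {N : ℕ}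

/-- `p(M) v = p(u) v` for `M v = u v`. [cite: HornJohnson2013, §1.1 Thm. 1.1.6] -/
theorem aeval_mulVec_of_mulVec_eq_smul {M : Matrix (Fin N) (Fin N) K} {u : K} {v : Fin N → K} (hv : M *ᵥ v = u • v) (p : K[X]) :
    (aeval M p) *ᵥ v = p.eval u • v := by
  have hpow : ∀ n : ℕ, (M ^ n) *ᵥ v = u ^ n • v := by
    intro n
    induction n with
    | zero => rw [pow_zero, pow_zero, Matrix.one_mulVec, one_smul]
    | succ n ih => rw [pow_succ, ← Matrix.mulVec_mulVec, hv, Matrix.mulVec_smul, ih, smul_smul, pow_succ, mul_comm]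
  rw [Polynomial.aeval_eq_sum_range, Polynomial.eval_eq_sum_range, Matrix.sum_mulVec, Finset.sum_smul]
  refine Finset.sum_congr rfl fun n _ => ?_
  rw [Matrix.smul_mulVec, hpow, smul_smul]

/-- `f p(M) = p(u) f` for a LEFT eigenvector `f M = u f` (Thm. 1.1.6 for `ᵗM`). [cite: HornJohnson2013, §1.1 Thm. 1.1.6; §1.4 Def. 1.4.6] -/
theorem vecMul_aeval_of_vecMul_eq_smul {M : Matrix (Fin N) (Fin N) K} {u : K} {f : Fin N → K} (hf : f ᵥ* M = u • f) (p : K[X]) :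
    f ᵥ* (aeval M p) = p.eval u • f := by
  have hpow : ∀ n : ℕ, f ᵥ* (M ^ n) = u ^ n • f := by
    intro n
    induction n with
    | zero => rw [pow_zero, pow_zero, Matrix.vecMul_one, one_smul]
    | succ n ih => rw [pow_succ', ← Matrix.vecMul_vecMul, hf, Matrix.smul_vecMul, ih, smul_smul, pow_succ']
  rw [Polynomial.aeval_eq_sum_range, Polynomial.eval_eq_sum_range, Matrix.vecMul_sum, Finset.sum_smul]
  refine Finset.sum_congr rfl fun n _ => ?_
  rw [Matrix.vecMul_smul, hpow, smul_smul]

/-- **The eigenspace of a SIMPLE eigenvalue is a line**: for `p_M` separable and `M v₀ = u v₀`, `v₀ ≠ 0`, every `w` with `M w = u w` is a multiple of `v₀`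
(geometric multiplicity `≤` algebraic multiplicity `≤ 1`; Mathlib `LinearMap.finrank_eigenspace_le`). [cite: HornJohnson2013, §1.4 Def. 1.4.3] -/
theorem exists_eq_smul_of_mulVec_eq_smul {M : Matrix (Fin N) (Fin N) K} (hsep : M.charpoly.Separable) {u : K} {v₀ : Fin N → K}
    (hv₀ : M *ᵥ v₀ = u • v₀) (hv₀0 : v₀ ≠ 0) {w : Fin N → K} (hw : M *ᵥ w = u • w) : ∃ c : K, w = c • v₀ := by
  set E := Module.End.eigenspace (Matrix.toLin' M) u with hE
  have hmem : ∀ x : Fin N → K, x ∈ E ↔ M *ᵥ x = u • x := fun x => by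
    rw [hE, Module.End.mem_eigenspace_iff, Matrix.toLin'_apply]
  have hle : Module.finrank K E ≤ 1 := by
    refine (LinearMap.finrank_eigenspace_le (Matrix.toLin' M) u).trans ?_
    rw [Matrix.charpoly_toLin']
    exact Polynomial.rootMultiplicity_le_one_of_separable hsep u
  have hpos : 0 < Module.finrank K E :=
    Module.finrank_pos_iff_exists_ne_zero.2 ⟨⟨v₀, (hmem v₀).2 hv₀⟩, fun h => hv₀0 (congrArg Subtype.val h)⟩
  have h1 : Module.finrank K E = 1 := le_antisymm hle hpos
  have hne : (⟨v₀, (hmem v₀).2 hv₀⟩ : E) ≠ 0 := fun h => hv₀0 (congrArg Subtype.val h)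
  obtain ⟨c, hc⟩ := (finrank_eq_one_iff_of_nonzero' _ hne).1 h1 ⟨w, (hmem w).2 hw⟩
  exact ⟨c, by simpa using (congrArg Subtype.val hc).symm⟩

/-- **At a simple unitary eigenvalue the eigenvector is not `H`-isotropic**: `H` invertible, `γ` `H`-unitary (`ᵗ(σγ) H γ = H`) with separable characteristic
polynomial, `γ v₀ = u v₀` with `u · σu = 1` and `v₀ ≠ 0` ⟹ `⟨v₀, v₀⟩_H = ᵗ(σv₀) H v₀ ≠ 0`.  (The row `ᵗ(σv₀) H` is a LEFT `u`-eigenvector of `γ`; left and right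
eigenvectors of a SIMPLE eigenvalue pair non-trivially [HornJohnson2013, Thm. 1.4.12 (a)]: with `p_γ = (X − u) q`, `q(u) ≠ 0`, the image of `q(γ)` is the `u`-eigenline.)
[cite: HornJohnson2013, §1.4 Thm. 1.4.12 (a)] [cite: Rogawski1990, §3.6 p. 31] -/
theorem hermForm_self_ne_zero_of_mulVec_eq_smul (σ : K →+* K) {H γ : Matrix (Fin N) (Fin N) K} (hHdet : IsUnit H.det) (hγ : (γ.map σ)ᵀ * H * γ = H)
    (hsep : γ.charpoly.Separable) {u : K} (hu : u * σ u = 1) {v₀ : Fin N → K} (hv₀ : γ *ᵥ v₀ = u • v₀) (hv₀0 : v₀ ≠ 0) :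
    hermForm σ H v₀ v₀ ≠ 0 := by
  classical
  set f : Fin N → K := (σ ∘ v₀) ᵥ* H with hf
  have hform : hermForm σ H v₀ v₀ = f ⬝ᵥ v₀ := Matrix.dotProduct_mulVec _ _ _
  -- `f` is a left `u`-eigenvector
  have hσv : (γ.map σ) *ᵥ (σ ∘ v₀) = σ u • (σ ∘ v₀) := by
    funext i
    rw [← RingHom.map_mulVec σ γ v₀ i, hv₀]
    simp only [Function.comp_apply, Pi.smul_apply, smul_eq_mul, map_mul]
  have hfγ : f ᵥ* γ = u • f := by
    have h1 : (σ ∘ v₀) ᵥ* ((γ.map σ)ᵀ * H * γ) = σ u • (f ᵥ* γ) := by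
      rw [← Matrix.vecMul_vecMul, ← Matrix.vecMul_vecMul, Matrix.vecMul_transpose, hσv, Matrix.smul_vecMul, Matrix.smul_vecMul]
    rw [hγ] at h1
    -- `f = σu • (f γ)` ⟹ `u • f = (u σu) • f γ = f γ`
    have h1' : f = σ u • (f ᵥ* γ) := h1
    have h2 : u • f = f ᵥ* γ := by
      conv_lhs => rw [h1']
      rw [smul_smul, hu, one_smul]
    exact h2.symm
  -- `f ≠ 0`
  have hf0 : f ≠ 0 := by
    intro h0
    have hinj : Function.Injective fun x : Fin N → K => x ᵥ* H := Matrix.vecMul_injective_iff_isUnit.2 (Matrix.isUnit_iff_isUnit_det _ |>.2 hHdet)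
    have hz : σ ∘ v₀ = 0 := hinj ((hf.symm.trans h0).trans (Matrix.zero_vecMul H).symm)
    apply hv₀0
    funext i
    have := congrFun hz i
    simpa using this
  -- the cofactor `q` of `X − u`
  have hroot : γ.charpoly.IsRoot u := by
    rw [Polynomial.IsRoot.def, Matrix.eval_charpoly]
    have : (Matrix.scalar (Fin N) u - γ) *ᵥ v₀ = 0 := by
      rw [Matrix.sub_mulVec, hv₀, Matrix.scalar_apply, ← Matrix.smul_one_eq_diagonal, Matrix.smul_mulVec, Matrix.one_mulVec, sub_self]
    exact (Matrix.exists_mulVec_eq_zero_iff.1 ⟨v₀, hv₀0, this⟩)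
  have hχ0 : γ.charpoly ≠ 0 := (Matrix.charpoly_monic γ).ne_zero
  set q : K[X] := γ.charpoly /ₘ (X - C u) with hqdef
  have hq : (X - C u) * q = γ.charpoly := (Polynomial.mul_divByMonic_eq_iff_isRoot).2 hroot
  have hqu : q.eval u ≠ 0 := by
    intro h0
    have hdvd : (X - C u) ^ 2 ∣ γ.charpoly := by
      rw [← hq, pow_two]
      exact mul_dvd_mul_left _ (Polynomial.dvd_iff_isRoot.2 h0)
    have h2 : 2 ≤ γ.charpoly.rootMultiplicity u := (Polynomial.le_rootMultiplicity_iff hχ0).2 hdvd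
    have h1 : γ.charpoly.rootMultiplicity u ≤ 1 := Polynomial.rootMultiplicity_le_one_of_separable hsep u
    omega
  -- `Q = q(γ)` maps into the `u`-eigenline
  set Q : Matrix (Fin N) (Fin N) K := aeval γ q with hQ
  have hγQ : γ * Q = u • Q := by
    have h0 : aeval γ ((X - C u) * q) = 0 := by rw [hq]; exact Matrix.aeval_self_charpoly γ
    rw [map_mul, map_sub, aeval_X, aeval_C, sub_mul, sub_eq_zero, Algebra.algebraMap_eq_smul_one, smul_mul_assoc, one_mul] at h0
    exact h0
  have hQw : ∀ w : Fin N → K, ∃ c : K, Q *ᵥ w = c • v₀ := fun w =>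
    exists_eq_smul_of_mulVec_eq_smul hsep hv₀ hv₀0 (by rw [Matrix.mulVec_mulVec, hγQ, Matrix.smul_mulVec])
  -- if `f v₀ = 0` then `f Q = 0`, but `f Q = q(u) f ≠ 0`
  rw [hform]
  intro h0
  have hfQ : f ᵥ* Q = 0 := by
    funext i
    obtain ⟨c, hc⟩ := hQw (Pi.single i 1)
    have h := Matrix.dotProduct_mulVec f Q (Pi.single i 1)
    rw [hc, dotProduct_smul, h0, smul_zero, dotProduct_single, mul_one] at h
    exact h.symm
  rw [vecMul_aeval_of_vecMul_eq_smul hfγ q] at hfQ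
  exact hf0 ((smul_eq_zero.1 hfQ).resolve_left hqu)

end Field

/-! ## §2 More linear algebra over a commutative ring: the hermitian form under scalars, transport and `σ` -/

section Form

variable {R : Type*} [CommRing R] {N : ℕ} (σ : R →+* R) (H : Matrix (Fin N) (Fin N) R)

/-- `(A.map f) (f ∘ v) = f ∘ (A v)` (Mathlib `RingHom.map_mulVec`, function form). [folklore] -/
private theorem map_mulVec_comp {S : Type*} [CommRing S] (f : R →+* S) (A : Matrix (Fin N) (Fin N) R) (v : Fin N → R) :
    A.map f *ᵥ (f ∘ v) = f ∘ (A *ᵥ v) := by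
  funext i
  exact (RingHom.map_mulVec f A v i).symm

/-- `⟨a x, b y⟩_H = σ(a) · b · ⟨x, y⟩_H`. [folklore] -/
private theorem hermForm_smul_smul_both (a b : R) (x y : Fin N → R) : hermForm σ H (a • x) (b • y) = σ a * b * hermForm σ H x y := by
  unfold hermForm
  have h : σ ∘ (a • x) = σ a • (σ ∘ x) := by
    funext i
    simp only [Function.comp_apply, Pi.smul_apply, smul_eq_mul, map_mul]
  rw [h, Matrix.mulVec_smul, smul_dotProduct, dotProduct_smul, smul_eq_mul, smul_eq_mul, mul_assoc]

/-- **Transport**: `⟨g x, g y⟩_H = ⟨x, y⟩_{H_g}` with `H_g = ᵗ(σg) H g` (★ `twistGram`). [cite: Rogawski1990, §3.1 p. 19] -/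
private theorem hermForm_mulVec_mulVec_eq_twistGram (g : Matrix (Fin N) (Fin N) R) (x y : Fin N → R) :
    hermForm σ H (g *ᵥ x) (g *ᵥ y) = hermForm σ (twistGram σ H g) x y := by
  unfold hermForm
  rw [twistGram_def, ← map_mulVec_comp σ g x, ← Matrix.vecMul_transpose, ← Matrix.dotProduct_mulVec, Matrix.mulVec_mulVec, Matrix.mulVec_mulVec]

/-- **Hermitian symmetry**: `σ ⟨x, y⟩_H = ⟨y, x⟩_H` for `σ` an involution and `ᵗ(σH) = H`. [folklore] -/
private theorem map_hermForm_eq_hermForm_swap (hσσ : ∀ r, σ (σ r) = r) (hH : (H.map σ)ᵀ = H) (x y : Fin N → R) :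
    σ (hermForm σ H x y) = hermForm σ H y x := by
  unfold hermForm
  have hx : σ ∘ (σ ∘ x) = x := funext fun i => hσσ (x i)
  rw [RingHom.map_dotProduct, hx, ← map_mulVec_comp σ H y, Matrix.dotProduct_mulVec, dotProduct_comm, ← Matrix.mulVec_transpose, hH]

/-- `⟨x, x⟩_H` is `σ`-fixed. [folklore] -/
private theorem map_hermForm_self (hσσ : ∀ r, σ (σ r) = r) (hH : (H.map σ)ᵀ = H) (x : Fin N → R) :
    σ (hermForm σ H x x) = hermForm σ H x x :=
  map_hermForm_eq_hermForm_swap σ H hσσ hH x x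

/-- `⟨x, y⟩_H` along a ring map intertwining the involutions. [folklore] -/
private theorem map_hermForm_of_comp {S : Type*} [CommRing S] (σ' : S →+* S) (f : R →+* S) (hf : ∀ r, f (σ r) = σ' (f r)) (x y : Fin N → R) :
    f (hermForm σ H x y) = hermForm σ' (H.map f) (f ∘ x) (f ∘ y) := by
  unfold hermForm
  have h : f ∘ (σ ∘ x) = σ' ∘ (f ∘ x) := funext fun i => hf (x i)
  rw [RingHom.map_dotProduct, ← map_mulVec_comp f H y, h]

end Form

/-! ## §3 CM letters: the degree-one factor `𝔪_u ∋ γ₀ − u`, its evaluation character `π_u : L[γ₀] → L`, and the eigenline of `γ₀` -/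

section DegreeOne

variable {L : Type} [Field L] [NumberField L] [IsCMField L] {H : Matrix (Fin 3) (Fin 3) L} {γ₀ : (UnitaryGroup.cmDatum L 3 H).Rational}

/-- **A degree-one factor carries an eigenvector**: `γ₀ − u ∈ 𝔪` (`𝔪` maximal in `L[γ₀]`) makes `u` a root of `p_{γ₀}` (★ `isRoot_charpoly_of_matrixGen_sub_algebraMap_mem`),
hence `γ₀ v₀ = u v₀` for some `v₀ ≠ 0` in `L³`. [cite: Rogawski1990, §3.6 p. 31] -/
theorem exists_mulVec_eq_smul_of_matrixGen_sub_algebraMap_mem (𝔪 : MaximalSpectrum ↥(cartanSubalgebra γ₀)) {u : L}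
    (hu : (⟨(((γ₀ : unitaryGroup (cmConjRingHom L) H).val : GL (Fin 3) L) : Matrix (Fin 3) (Fin 3) L), Algebra.self_mem_adjoin_singleton L _⟩ : ↥(cartanSubalgebra γ₀)) -
      algebraMap L ↥(cartanSubalgebra γ₀) u ∈ 𝔪.asIdeal) :
    ∃ v₀ : Fin 3 → L, v₀ ≠ 0 ∧ (((γ₀ : unitaryGroup (cmConjRingHom L) H).val : GL (Fin 3) L) : Matrix (Fin 3) (Fin 3) L) *ᵥ v₀ = u • v₀ := by
  set γM : Matrix (Fin 3) (Fin 3) L := (((γ₀ : unitaryGroup (cmConjRingHom L) H).val : GL (Fin 3) L) : Matrix (Fin 3) (Fin 3) L) with hγM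
  have hroot : γM.charpoly.IsRoot u := isRoot_charpoly_of_matrixGen_sub_algebraMap_mem γM 𝔪 hu
  have hdet : (Matrix.scalar (Fin 3) u - γM).det = 0 := by rw [← Matrix.eval_charpoly]; exact hroot
  obtain ⟨v, hv0, hv⟩ := Matrix.exists_mulVec_eq_zero_iff.2 hdet
  refine ⟨v, hv0, ?_⟩
  rw [Matrix.sub_mulVec, sub_eq_zero, Matrix.scalar_apply, ← Matrix.smul_one_eq_diagonal, Matrix.smul_mulVec, Matrix.one_mulVec] at hv
  exact hv.symm

/-- `τ` is `σ`-SEMILINEAR on the scalars `L ⊂ L[γ₀]`: `τ(c · 1) = σ(c) · 1`. [cite: Rogawski1990, §3.5 p. 29] -/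
theorem cartanInvolutionCM_algebraMap (hH : (H.map (cmConjRingHom L))ᵀ = H) (hHd : IsUnit H.det)
    (hreg : IsRegularElt ((γ₀ : unitaryGroup (cmConjRingHom L) H).val : GL (Fin 3) L)) (c : L) :
    cartanInvolutionCM hH hHd hreg (algebraMap L ↥(cartanSubalgebra γ₀) c) = algebraMap L ↥(cartanSubalgebra γ₀) (cmConjRingHom L c) := by
  apply Subtype.ext
  rw [coe_cartanInvolutionCM, Subalgebra.coe_algebraMap, Subalgebra.coe_algebraMap, Algebra.algebraMap_eq_smul_one, Algebra.algebraMap_eq_smul_one,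
    hermStar_smul, hermStar_one _ _ hHd]

/-- **A τ-STABLE degree-one factor has a UNITARY eigenvalue**: `γ₀ − u ∈ 𝔪` with `τ𝔪 = 𝔪` forces `u · σ(u) = 1` (`τ(γ₀ − u) = γ₀⁻¹ − σu ∈ 𝔪`).
[cite: Rogawski1990, §3.5 Prop. 3.5.2 (c) p. 29; §3.6 p. 31] -/
theorem mul_cmConj_eq_one_of_matrixGen_sub_algebraMap_mem (hH : (H.map (cmConjRingHom L))ᵀ = H) (hHd : IsUnit H.det)
    (hreg : IsRegularElt ((γ₀ : unitaryGroup (cmConjRingHom L) H).val : GL (Fin 3) L)) (𝔪 : cartanIndexCM hH hHd hreg) {u : L}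
    (hu : (⟨(((γ₀ : unitaryGroup (cmConjRingHom L) H).val : GL (Fin 3) L) : Matrix (Fin 3) (Fin 3) L), Algebra.self_mem_adjoin_singleton L _⟩ : ↥(cartanSubalgebra γ₀)) -
      algebraMap L ↥(cartanSubalgebra γ₀) u ∈ 𝔪.1.asIdeal) :
    u * cmConjRingHom L u = 1 := by
  set γM : Matrix (Fin 3) (Fin 3) L := (((γ₀ : unitaryGroup (cmConjRingHom L) H).val : GL (Fin 3) L) : Matrix (Fin 3) (Fin 3) L) with hγM
  set γB : ↥(cartanSubalgebra γ₀) := ⟨γM, Algebra.self_mem_adjoin_singleton L γM⟩ with hγB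
  set τ := cartanInvolutionCM hH hHd hreg with hτ
  set I := 𝔪.1.asIdeal with hI
  have hτγ : τ γB * γB = 1 := Subtype.ext
    (coe_cartanInvolution_self_mul_self (cmConjRingHom L) (cmConjRingHom_algebraMap L) (IsCMField.complexConj_apply_apply L) hHd hH hreg
      (transpose_map_mul_mul_eq_of_rational γ₀))
  -- `τ(γ₀ − u) ∈ 𝔪`
  have hτu : τ γB - algebraMap L ↥(cartanSubalgebra γ₀) (cmConjRingHom L u) ∈ I := by
    have h : γB - algebraMap L ↥(cartanSubalgebra γ₀) u ∈ I.comap τ := (SetLike.ext_iff.1 𝔪.2 _).2 hu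
    rw [Ideal.mem_comap, map_sub] at h
    change τ γB - τ (algebraMap L ↥(cartanSubalgebra γ₀) u) ∈ I at h
    rwa [hτ, cartanInvolutionCM_algebraMap hH hHd hreg] at h
  -- `1 − σu·u = (τγ₀ − σu)·γ₀ + σu·(γ₀ − u) ∈ 𝔪`
  have hsum : algebraMap L ↥(cartanSubalgebra γ₀) (1 - cmConjRingHom L u * u) ∈ I := by
    have h1 : (τ γB - algebraMap L ↥(cartanSubalgebra γ₀) (cmConjRingHom L u)) * γB ∈ I := I.mul_mem_right _ hτu
    have h2 : algebraMap L ↥(cartanSubalgebra γ₀) (cmConjRingHom L u) * (γB - algebraMap L ↥(cartanSubalgebra γ₀) u) ∈ I := I.mul_mem_left _ hu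
    have h := I.add_mem h1 h2
    have heq : (τ γB - algebraMap L ↥(cartanSubalgebra γ₀) (cmConjRingHom L u)) * γB +
        algebraMap L ↥(cartanSubalgebra γ₀) (cmConjRingHom L u) * (γB - algebraMap L ↥(cartanSubalgebra γ₀) u) =
        algebraMap L ↥(cartanSubalgebra γ₀) (1 - cmConjRingHom L u * u) := by
      rw [map_sub, map_one, map_mul, ← hτγ]; ring
    rwa [heq] at h
  have h0 := (algebraMap_mem_maximalSpectrum_adjoin_iff γM 𝔪.1 _).1 hsum
  rw [mul_comm]
  exact (sub_eq_zero.1 h0).symm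

/-- **The evaluation character of a degree-one factor EXISTS**: for `γ₀ − u ∈ 𝔪` there is an `L`-algebra map `π : L[γ₀] → L` with kernel exactly `𝔪`
(`L → L[γ₀] ∕ 𝔪` is bijective, ★ `surjective_algebraMap_adjoin_singleton_quotient`). [cite: Rogawski1990, §3.6 p. 31] -/
theorem exists_algHom_ker_eq_of_matrixGen_sub_algebraMap_mem (𝔪 : MaximalSpectrum ↥(cartanSubalgebra γ₀)) {u : L}
    (hu : (⟨(((γ₀ : unitaryGroup (cmConjRingHom L) H).val : GL (Fin 3) L) : Matrix (Fin 3) (Fin 3) L), Algebra.self_mem_adjoin_singleton L _⟩ : ↥(cartanSubalgebra γ₀)) -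
      algebraMap L ↥(cartanSubalgebra γ₀) u ∈ 𝔪.asIdeal) :
    ∃ π : ↥(cartanSubalgebra γ₀) →ₐ[L] L, ∀ b, π b = 0 ↔ b ∈ 𝔪.asIdeal := by
  haveI : Nontrivial (↥(cartanSubalgebra γ₀) ⧸ 𝔪.asIdeal) := Ideal.Quotient.nontrivial_iff.2 𝔪.isMaximal.ne_top
  have hbij : Function.Bijective (Algebra.ofId L (↥(cartanSubalgebra γ₀) ⧸ 𝔪.asIdeal)) :=
    ⟨(algebraMap L (↥(cartanSubalgebra γ₀) ⧸ 𝔪.asIdeal)).injective, surjective_algebraMap_adjoin_singleton_quotient _ 𝔪.asIdeal hu⟩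
  let e : L ≃ₐ[L] (↥(cartanSubalgebra γ₀) ⧸ 𝔪.asIdeal) := AlgEquiv.ofBijective _ hbij
  refine ⟨e.symm.toAlgHom.comp (Ideal.Quotient.mkₐ L 𝔪.asIdeal), fun b => ?_⟩
  change e.symm (Ideal.Quotient.mk 𝔪.asIdeal b) = 0 ↔ _
  rw [map_eq_zero_iff _ e.symm.injective, Ideal.Quotient.eq_zero_iff_mem]

variable {𝔪 : MaximalSpectrum ↥(cartanSubalgebra γ₀)} {u : L} {π : ↥(cartanSubalgebra γ₀) →ₐ[L] L}

/-- The evaluation character sends `γ₀ ↦ u`. [cite: Rogawski1990, §3.6 p. 31] -/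
theorem apply_matrixGen_eq_of_ker (hker : ∀ b, π b = 0 ↔ b ∈ 𝔪.asIdeal)
    (hu : (⟨(((γ₀ : unitaryGroup (cmConjRingHom L) H).val : GL (Fin 3) L) : Matrix (Fin 3) (Fin 3) L), Algebra.self_mem_adjoin_singleton L _⟩ : ↥(cartanSubalgebra γ₀)) -
      algebraMap L ↥(cartanSubalgebra γ₀) u ∈ 𝔪.asIdeal) :
    π ⟨(((γ₀ : unitaryGroup (cmConjRingHom L) H).val : GL (Fin 3) L) : Matrix (Fin 3) (Fin 3) L), Algebra.self_mem_adjoin_singleton L _⟩ = u := by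
  have h := (hker _).2 hu
  rwa [map_sub, AlgHom.commutes, sub_eq_zero] at h

/-- The evaluation character is onto (`π (c · 1) = c`). [folklore] -/
private theorem surjective_of_algHom (π : ↥(cartanSubalgebra γ₀) →ₐ[L] L) : Function.Surjective π :=
  fun c => ⟨algebraMap L _ c, AlgHom.commutes π c⟩

/-- `π (p(γ₀)) = p(u)`. [cite: Rogawski1990, §3.6 p. 31] -/
theorem apply_aeval_matrixGen_eq_eval (hker : ∀ b, π b = 0 ↔ b ∈ 𝔪.asIdeal)
    (hu : (⟨(((γ₀ : unitaryGroup (cmConjRingHom L) H).val : GL (Fin 3) L) : Matrix (Fin 3) (Fin 3) L), Algebra.self_mem_adjoin_singleton L _⟩ : ↥(cartanSubalgebra γ₀)) -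
      algebraMap L ↥(cartanSubalgebra γ₀) u ∈ 𝔪.asIdeal) (p : L[X]) :
    π (aeval (⟨(((γ₀ : unitaryGroup (cmConjRingHom L) H).val : GL (Fin 3) L) : Matrix (Fin 3) (Fin 3) L), Algebra.self_mem_adjoin_singleton L _⟩ : ↥(cartanSubalgebra γ₀)) p) =
      p.eval u := by
  rw [← aeval_algHom_apply, apply_matrixGen_eq_of_ker hker hu, coe_aeval_eq_eval]

/-- **`L[γ₀]` acts on the `u`-eigenline of `γ₀` through `π_u`**: `b v₀ = π(b) v₀` for `γ₀ v₀ = u v₀`. [cite: Rogawski1990, §3.6 p. 31] -/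
theorem coe_mulVec_eq_smul_of_ker (hker : ∀ b, π b = 0 ↔ b ∈ 𝔪.asIdeal)
    (hu : (⟨(((γ₀ : unitaryGroup (cmConjRingHom L) H).val : GL (Fin 3) L) : Matrix (Fin 3) (Fin 3) L), Algebra.self_mem_adjoin_singleton L _⟩ : ↥(cartanSubalgebra γ₀)) -
      algebraMap L ↥(cartanSubalgebra γ₀) u ∈ 𝔪.asIdeal) {v₀ : Fin 3 → L}
    (hv₀ : (((γ₀ : unitaryGroup (cmConjRingHom L) H).val : GL (Fin 3) L) : Matrix (Fin 3) (Fin 3) L) *ᵥ v₀ = u • v₀) (b : ↥(cartanSubalgebra γ₀)) :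
    (b : Matrix (Fin 3) (Fin 3) L) *ᵥ v₀ = π b • v₀ := by
  obtain ⟨p, rfl⟩ := exists_eq_aeval_matrixGen _ b
  rw [aeval_subalgebra_coe, aeval_mulVec_of_mulVec_eq_smul hv₀, apply_aeval_matrixGen_eq_eval hker hu]

/-- **`π_u ∘ τ = c ∘ π_u`** — the evaluation character of a τ-stable degree-one factor intertwines the Cartan involution with complex conjugation
(`τ(p(γ₀)) = (σp)(γ₀⁻¹)` and `u⁻¹ = σu`). [cite: Rogawski1990, §3.5 Prop. 3.5.2 (c) p. 29] -/
theorem apply_cartanInvolutionCM_eq_cmConj (hH : (H.map (cmConjRingHom L))ᵀ = H) (hHd : IsUnit H.det)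
    (hreg : IsRegularElt ((γ₀ : unitaryGroup (cmConjRingHom L) H).val : GL (Fin 3) L)) (hker : ∀ b, π b = 0 ↔ b ∈ 𝔪.asIdeal)
    (hu : (⟨(((γ₀ : unitaryGroup (cmConjRingHom L) H).val : GL (Fin 3) L) : Matrix (Fin 3) (Fin 3) L), Algebra.self_mem_adjoin_singleton L _⟩ : ↥(cartanSubalgebra γ₀)) -
      algebraMap L ↥(cartanSubalgebra γ₀) u ∈ 𝔪.asIdeal) (hu1 : u * cmConjRingHom L u = 1) (b : ↥(cartanSubalgebra γ₀)) :
    π (cartanInvolutionCM hH hHd hreg b) = cmConjRingHom L (π b) := by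
  set γM : Matrix (Fin 3) (Fin 3) L := (((γ₀ : unitaryGroup (cmConjRingHom L) H).val : GL (Fin 3) L) : Matrix (Fin 3) (Fin 3) L) with hγM
  set γB : ↥(cartanSubalgebra γ₀) := ⟨γM, Algebra.self_mem_adjoin_singleton L γM⟩ with hγB
  set τ := cartanInvolutionCM hH hHd hreg with hτ
  have hπγ : π γB = u := apply_matrixGen_eq_of_ker hker hu
  have hτγ : τ γB * γB = 1 := Subtype.ext
    (coe_cartanInvolution_self_mul_self (cmConjRingHom L) (cmConjRingHom_algebraMap L) (IsCMField.complexConj_apply_apply L) hHd hH hreg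
      (transpose_map_mul_mul_eq_of_rational γ₀))
  have hu0 : u ≠ 0 := fun h => by rw [h, zero_mul] at hu1; exact zero_ne_one hu1
  have hπτγ : π (τ γB) = cmConjRingHom L u := by
    have h := congrArg π hτγ
    rw [map_mul, map_one, hπγ] at h
    -- `π(τγ₀) · u = 1 = σu · u`
    have h' : cmConjRingHom L u * u = 1 := by rw [mul_comm]; exact hu1
    exact mul_right_cancel₀ hu0 (h.trans h'.symm)
  have hcomp : (τ : ↥(cartanSubalgebra γ₀) →+* ↥(cartanSubalgebra γ₀)).comp (algebraMap L ↥(cartanSubalgebra γ₀)) =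
      (algebraMap L ↥(cartanSubalgebra γ₀)).comp (cmConjRingHom L) :=
    RingHom.ext fun c => cartanInvolutionCM_algebraMap hH hHd hreg c
  obtain ⟨p, rfl⟩ := exists_eq_aeval_matrixGen γM b
  change π (τ (aeval γB p)) = cmConjRingHom L (π (aeval γB p))
  rw [apply_aeval_matrixGen_eq_eval hker hu, aeval_def, ← RingHom.coe_coe τ, hom_eval₂, hcomp, ← eval₂_map, ← aeval_def, ← aeval_algHom_apply, RingHom.coe_coe,
    hπτγ, coe_aeval_eq_eval, eval_map, eval₂_at_apply]

end DegreeOne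

/-! ## §4 The adelic Cartan algebra on the eigenline: `Ψ(X) · (v₀ ⊗ 1) = e((1 ⊗ π_u) X) · (v₀ ⊗ 1)` -/

section Eigenline

variable {L : Type} [Field L] [NumberField L] [IsCMField L] {H : Matrix (Fin 3) (Fin 3) L} {γ₀ : (UnitaryGroup.cmDatum L 3 H).Rational}

/-- **`Ψ(X)` acts on the `u`-eigenline `v₀ ⊗ 1 ⊂ 𝔸_L³` of `γ₀ ⊗ 1` by the SCALAR `e((1 ⊗ π_u) X) ∈ 𝔸_L`** — the `π_u`-component of `X ∈ 𝔸_{L⁺} ⊗ L[γ₀]` read through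
Cassels–Fröhlich's `e : 𝔸_{L⁺} ⊗_{L⁺} L ≅ 𝔸_L` (★ `adeleRingTensorAlgEquiv`); on pure tensors `Ψ(r ⊗ b)(v₀ ⊗ 1) = con(r) · (b v₀ ⊗ 1) = con(r) π(b) · (v₀ ⊗ 1)`.
[cite: CasselsFrohlichANT1967, Ch. II §19 (19.1)] [cite: Rogawski1990, §3.5 Prop. 3.5.2 (c) p. 29] -/
theorem adelicCartanGlue_mulVec_eq_smul (π : ↥(cartanSubalgebra γ₀) →ₐ[L] L) {v₀ : Fin 3 → L}
    (hπv : ∀ b : ↥(cartanSubalgebra γ₀), (b : Matrix (Fin 3) (Fin 3) L) *ᵥ v₀ = π b • v₀) (X : adelicCartanAlgebra γ₀) :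
    adelicCartanGlue (F := ↥(maximalRealSubfield L)) (cartanSubalgebra γ₀) X *ᵥ ((algebraMap L (AdeleRing (𝓞 L) L)) ∘ v₀) =
      adeleRingTensorAlgEquiv (↥(maximalRealSubfield L)) L
        (Algebra.TensorProduct.map (AlgHom.id (AdeleRing (𝓞 ↥(maximalRealSubfield L)) ↥(maximalRealSubfield L)) (AdeleRing (𝓞 ↥(maximalRealSubfield L)) ↥(maximalRealSubfield L)))
          (π.restrictScalars ↥(maximalRealSubfield L)) X) • ((algebraMap L (AdeleRing (𝓞 L) L)) ∘ v₀) := by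
  induction X using TensorProduct.induction_on with
  | zero => rw [map_zero, map_zero, map_zero, Matrix.zero_mulVec, zero_smul]
  | tmul r b =>
      rw [adelicCartanGlue_tmul, Matrix.smul_mulVec, map_mulVec_comp, hπv b, Algebra.TensorProduct.map_tmul, AlgHom.id_apply,
        AlgHom.restrictScalars_apply, adeleRingTensorAlgEquiv_tmul]
      have h : (algebraMap L (AdeleRing (𝓞 L) L)) ∘ (π b • v₀) = algebraMap L (AdeleRing (𝓞 L) L) (π b) • ((algebraMap L (AdeleRing (𝓞 L) L)) ∘ v₀) := by
        funext i
        simp only [Function.comp_apply, Pi.smul_apply, smul_eq_mul, map_mul]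
      rw [h, smul_smul, mul_comm]
  | add x y hx hy => rw [map_add, map_add, map_add, Matrix.add_mulVec, hx, hy, add_smul]

/-- **The commutant of `γ₀ ⊗ 1` acts on the eigenline by UNITS**: `t ∈ GL₃(𝔸_L)` commuting with `γ₀ ⊗ 1` (`γ₀` regular) satisfies `t (v₀ ⊗ 1) = c · (v₀ ⊗ 1)` with
`c ∈ 𝔸_Lˣ` (`t = Ψ(T)`, `t⁻¹ = Ψ(T′)`, ★ (G1)(G2); `c = e((1 ⊗ π_u) T)`). [cite: Rogawski1990, §3.3 (3.3.1) p. 22; §3.5 p. 29] -/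
theorem exists_isUnit_mulVec_eq_smul_of_commute (hreg : IsRegularElt ((γ₀ : unitaryGroup (cmConjRingHom L) H).val : GL (Fin 3) L))
    (π : ↥(cartanSubalgebra γ₀) →ₐ[L] L) {v₀ : Fin 3 → L} (hπv : ∀ b : ↥(cartanSubalgebra γ₀), (b : Matrix (Fin 3) (Fin 3) L) *ᵥ v₀ = π b • v₀)
    (t : GL (Fin 3) (AdeleRing (𝓞 L) L))
    (ht : t * (((UnitaryGroup.cmDatum L 3 H).toAdelic γ₀).val : GL (Fin 3) (AdeleRing (𝓞 L) L)) = (((UnitaryGroup.cmDatum L 3 H).toAdelic γ₀).val : GL (Fin 3) (AdeleRing (𝓞 L) L)) * t) :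
    ∃ c : AdeleRing (𝓞 L) L, IsUnit c ∧ (t : Matrix (Fin 3) (Fin 3) (AdeleRing (𝓞 L) L)) *ᵥ ((algebraMap L (AdeleRing (𝓞 L) L)) ∘ v₀) = c • ((algebraMap L (AdeleRing (𝓞 L) L)) ∘ v₀) := by
  set γM : Matrix (Fin 3) (Fin 3) L := (((γ₀ : unitaryGroup (cmConjRingHom L) H).val : GL (Fin 3) L) : Matrix (Fin 3) (Fin 3) L) with hγM
  have hregM : γM.charpoly.Separable := hreg
  have hγA : ((((UnitaryGroup.cmDatum L 3 H).toAdelic γ₀).val : GL (Fin 3) (AdeleRing (𝓞 L) L)) : Matrix (Fin 3) (Fin 3) (AdeleRing (𝓞 L) L)) = γM.map (algebraMap L (AdeleRing (𝓞 L) L)) := rfl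
  have hγB : γM ∈ cartanSubalgebra γ₀ := Algebra.self_mem_adjoin_singleton L _
  have hinj : Function.Injective (adelicCartanGlue (F := ↥(maximalRealSubfield L)) (cartanSubalgebra γ₀)) := adelicCartanGlue_injective _
  have htγ : Commute (γM.map (algebraMap L (AdeleRing (𝓞 L) L))) (t : Matrix (Fin 3) (Fin 3) (AdeleRing (𝓞 L) L)) := by
    have := congrArg (fun u : GL (Fin 3) (AdeleRing (𝓞 L) L) => (u : Matrix (Fin 3) (Fin 3) (AdeleRing (𝓞 L) L))) ht
    simp only [Units.val_mul] at this
    rw [← hγA]; exact this.symm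
  have ht'γ : Commute (γM.map (algebraMap L (AdeleRing (𝓞 L) L))) ((t⁻¹ : GL (Fin 3) (AdeleRing (𝓞 L) L)) : Matrix (Fin 3) (Fin 3) (AdeleRing (𝓞 L) L)) := by
    have hc : Commute t (((UnitaryGroup.cmDatum L 3 H).toAdelic γ₀).val : GL (Fin 3) (AdeleRing (𝓞 L) L)) := ht
    have := congrArg (fun u : GL (Fin 3) (AdeleRing (𝓞 L) L) => (u : Matrix (Fin 3) (Fin 3) (AdeleRing (𝓞 L) L))) hc.inv_left.eq
    simp only [Units.val_mul] at this
    rw [← hγA]; exact this.symm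
  obtain ⟨T₁, hT₁⟩ := mem_range_adelicCartanGlue_of_commute (F := ↥(maximalRealSubfield L)) (cartanSubalgebra γ₀) hγB hregM htγ
  obtain ⟨T₁', hT₁'⟩ := mem_range_adelicCartanGlue_of_commute (F := ↥(maximalRealSubfield L)) (cartanSubalgebra γ₀) hγB hregM ht'γ
  have hTT : T₁ * T₁' = 1 := hinj (by rw [map_mul, hT₁, hT₁', ← Units.val_mul, mul_inv_cancel, Units.val_one, map_one])
  set E := fun Y : adelicCartanAlgebra γ₀ => adeleRingTensorAlgEquiv (↥(maximalRealSubfield L)) L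
    (Algebra.TensorProduct.map (AlgHom.id (AdeleRing (𝓞 ↥(maximalRealSubfield L)) ↥(maximalRealSubfield L)) (AdeleRing (𝓞 ↥(maximalRealSubfield L)) ↥(maximalRealSubfield L)))
      (π.restrictScalars ↥(maximalRealSubfield L)) Y) with hE
  have hunit : E T₁ * E T₁' = 1 := by
    simp only [hE]
    rw [← map_mul, ← map_mul, hTT, map_one, map_one]
  refine ⟨E T₁, IsUnit.of_mul_eq_one (E T₁') hunit, ?_⟩
  rw [← hT₁, adelicCartanGlue_mulVec_eq_smul π hπv]

end Eigenline

/-! ## §5 The obstruction at the degree-one factor: «global × norm» on the `H`-value of the eigenvector -/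

section Obstruction

variable {L : Type} [Field L] [NumberField L] [IsCMField L] {H : Matrix (Fin 3) (Fin 3) L} {γ₀ : (UnitaryGroup.cmDatum L 3 H).Rational}

/-- «Global × norm» is stable under a non-zero `c`-FIXED GLOBAL factor (bookkeeping). [cite: Rogawski1990, §3.8 Prop. 3.8.1 (d) p. 37] -/
theorem isPrincipalAdelicNorm_mul_algebraMap_iff {k : L} (hk0 : k ≠ 0) (hkc : cmConjRingHom L k = k) (δ : AdeleRing (𝓞 L) L) :
    IsPrincipalAdelicNorm L (δ * algebraMap L (AdeleRing (𝓞 L) L) k) ↔ IsPrincipalAdelicNorm L δ := by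
  have key : ∀ {k' : L} (δ' : AdeleRing (𝓞 L) L), k' ≠ 0 → cmConjRingHom L k' = k' → IsPrincipalAdelicNorm L δ' →
      IsPrincipalAdelicNorm L (δ' * algebraMap L (AdeleRing (𝓞 L) L) k') := by
    rintro k' δ' hk'0 hk'c ⟨a, z, ha0, hac, rfl⟩
    refine ⟨a * k', z, mul_ne_zero ha0 hk'0, by rw [map_mul, hac, hk'c], ?_⟩
    rw [map_mul]; ring
  refine ⟨fun h => ?_, key δ hk0 hkc⟩
  have h' := key _ (inv_ne_zero hk0) (by rw [map_inv₀, hkc]) h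
  rwa [mul_assoc, ← map_mul, mul_inv_cancel₀ hk0, map_one, mul_one] at h'

/-- **THE OBSTRUCTION AT A DEGREE-ONE FACTOR, FACTOR-IMAGE FORM**: for the τ-stable factor `𝔪 ∋ γ₀ − u` with evaluation character `π : L[γ₀] → L`
(kernel `𝔪`), `(obs p)_𝔪 = 0` iff the `π`-component `e((1 ⊗ π) X_p) ∈ 𝔸_L` of the adelic Cartan class is «GLOBAL × NORM» (★ `IsPrincipalAdelicNorm`) —
★ `isPrincipalNormAt_iff_exists_repr` through A-p14's factor calculus (★ `adeleRingTensorAlgEquiv_map_tmul_mul_mul_map`, ★ `exists_repr_of_adeleRingTensorAlgEquiv_map_eq`)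
at `τ_C := c`, `π ∘ τ = c ∘ π`. [cite: Rogawski1990, §3.5 Prop. 3.5.2 (c) p. 29; §3.3 (3.3.1) p. 22] [cite: Kottwitz1986, §9] [cite: CasselsFrohlichANT1967, Ch. VII §7.1] -/
theorem MatchingAdeleG₂.cartanObsFun_eq_zero_iff_isPrincipalAdelicNorm_map (hH : (H.map (cmConjRingHom L))ᵀ = H) (hHd : IsUnit H.det)
    (hreg : IsRegularElt ((γ₀ : unitaryGroup (cmConjRingHom L) H).val : GL (Fin 3) L)) (p : MatchingAdeleG₂ L H H γ₀) (𝔪 : cartanIndexCM hH hHd hreg) {u : L}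
    (hu : (⟨(((γ₀ : unitaryGroup (cmConjRingHom L) H).val : GL (Fin 3) L) : Matrix (Fin 3) (Fin 3) L), Algebra.self_mem_adjoin_singleton L _⟩ : ↥(cartanSubalgebra γ₀)) -
      algebraMap L ↥(cartanSubalgebra γ₀) u ∈ 𝔪.1.asIdeal)
    (π : ↥(cartanSubalgebra γ₀) →ₐ[L] L) (hker : ∀ b, π b = 0 ↔ b ∈ 𝔪.1.asIdeal) :
    p.cartanObsFun hH hHd hreg 𝔪 = 0 ↔
      IsPrincipalAdelicNorm L (adeleRingTensorAlgEquiv (↥(maximalRealSubfield L)) L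
        (Algebra.TensorProduct.map (AlgHom.id (AdeleRing (𝓞 ↥(maximalRealSubfield L)) ↥(maximalRealSubfield L)) (AdeleRing (𝓞 ↥(maximalRealSubfield L)) ↥(maximalRealSubfield L)))
          (π.restrictScalars ↥(maximalRealSubfield L)) ((p.adelicCartanRepr hH hHd hreg : (adelicCartanAlgebra γ₀)ˣ) : adelicCartanAlgebra γ₀))) := by
  set τ := cartanInvolutionCM hH hHd hreg with hτ
  set πF : ↥(cartanSubalgebra γ₀) →ₐ[↥(maximalRealSubfield L)] L := π.restrictScalars ↥(maximalRealSubfield L) with hπF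
  set E := fun Y : adelicCartanAlgebra γ₀ => adeleRingTensorAlgEquiv (↥(maximalRealSubfield L)) L
    (Algebra.TensorProduct.map (AlgHom.id (AdeleRing (𝓞 ↥(maximalRealSubfield L)) ↥(maximalRealSubfield L)) (AdeleRing (𝓞 ↥(maximalRealSubfield L)) ↥(maximalRealSubfield L))) πF Y)
    with hE
  have hu1 : u * cmConjRingHom L u = 1 := mul_cmConj_eq_one_of_matrixGen_sub_algebraMap_mem hH hHd hreg 𝔪 hu
  have hτπ : ∀ b, πF (τ b) = (IsCMField.complexConj L) (πF b) := fun b => apply_cartanInvolutionCM_eq_cmConj hH hHd hreg hker hu hu1 b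
  have hsurj : Function.Surjective πF := surjective_of_algHom π
  have hkerF : ∀ b, πF b = 0 ↔ b ∈ 𝔪.1.asIdeal := hker
  set X : adelicCartanAlgebra γ₀ := ((p.adelicCartanRepr hH hHd hreg : (adelicCartanAlgebra γ₀)ˣ) : adelicCartanAlgebra γ₀) with hX
  rw [p.cartanObsFun_eq_zero_iff hH hHd hreg 𝔪, isPrincipalNormAt_iff_exists_repr hH hHd hreg X 𝔪.1 πF hsurj hkerF]
  change _ ↔ IsPrincipalAdelicNorm L (E X)
  constructor
  · rintro ⟨k, w, w', hk0, hkτ, hww', hXe⟩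
    have hE1 : E X = algebraMap L (AdeleRing (𝓞 L) L) (πF k) * (E w * (IsCMField.complexConj L) • E w) := by
      simp only [hE]
      rw [hXe]
      exact adeleRingTensorAlgEquiv_map_tmul_mul_mul_map τ πF (IsCMField.complexConj L) hτπ k w
    have hw : IsUnit (E w) := IsUnit.of_mul_eq_one (E w') (by simp only [hE, ← map_mul, hww', map_one])
    refine ⟨πF k, hw.unit, hk0, ?_, ?_⟩
    · rw [cmConjRingHom_apply, ← hτπ k, hkτ]
    · rw [hE1, IsUnit.unit_spec, adeleConj_apply, mul_comm (E w)]
  · rintro ⟨k', z, hk'0, hk'c, hEq⟩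
    have hk'c' : (IsCMField.complexConj L) k' = k' := by rw [← cmConjRingHom_apply]; exact hk'c
    refine exists_repr_of_adeleRingTensorAlgEquiv_map_eq τ πF (IsCMField.complexConj L) hτπ hsurj hk'0 hk'c' z ?_
    change E X = _
    rw [hEq, adeleConj_apply, mul_comm ((IsCMField.complexConj L) • (z : AdeleRing (𝓞 L) L))]

/-- **The `H`-value on the transported eigenvector reads the factor image**: for the chosen adelic conjugator `g(p)`,
`⟨g(p)(v₀ ⊗ 1), g(p)(v₀ ⊗ 1)⟩_{H ⊗ 1} = e((1 ⊗ π_u) X_p) · (⟨v₀, v₀⟩_H ⊗ 1)` (`ᵗ(c g) (H⊗1) g = (H⊗1) · x_g`, `x_g (v₀⊗1) = e(…) (v₀⊗1)`).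
[cite: Rogawski1990, §3.3 (3.3.1) p. 22; §3.5 Prop. 3.5.2 (c) p. 29] -/
theorem MatchingAdeleG₂.hermForm_adelicConjugator_mulVec_eq (hH : (H.map (cmConjRingHom L))ᵀ = H) (hHd : IsUnit H.det)
    (hreg : IsRegularElt ((γ₀ : unitaryGroup (cmConjRingHom L) H).val : GL (Fin 3) L)) (p : MatchingAdeleG₂ L H H γ₀)
    (π : ↥(cartanSubalgebra γ₀) →ₐ[L] L) {v₀ : Fin 3 → L} (hπv : ∀ b : ↥(cartanSubalgebra γ₀), (b : Matrix (Fin 3) (Fin 3) L) *ᵥ v₀ = π b • v₀) :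
    hermForm (adeleConj L) (H.map (algebraMap L (AdeleRing (𝓞 L) L)))
        (((p.adelicConjugator hreg : GL (Fin 3) (AdeleRing (𝓞 L) L)) : Matrix (Fin 3) (Fin 3) (AdeleRing (𝓞 L) L)) *ᵥ ((algebraMap L (AdeleRing (𝓞 L) L)) ∘ v₀))
        (((p.adelicConjugator hreg : GL (Fin 3) (AdeleRing (𝓞 L) L)) : Matrix (Fin 3) (Fin 3) (AdeleRing (𝓞 L) L)) *ᵥ ((algebraMap L (AdeleRing (𝓞 L) L)) ∘ v₀)) =
      adeleRingTensorAlgEquiv (↥(maximalRealSubfield L)) L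
          (Algebra.TensorProduct.map (AlgHom.id (AdeleRing (𝓞 ↥(maximalRealSubfield L)) ↥(maximalRealSubfield L)) (AdeleRing (𝓞 ↥(maximalRealSubfield L)) ↥(maximalRealSubfield L)))
            (π.restrictScalars ↥(maximalRealSubfield L)) ((p.adelicCartanRepr hH hHd hreg : (adelicCartanAlgebra γ₀)ˣ) : adelicCartanAlgebra γ₀)) *
        algebraMap L (AdeleRing (𝓞 L) L) (hermForm (cmConjRingHom L) H v₀ v₀) := by
  rw [hermForm_mulVec_mulVec_eq_twistGram,
    ← Matrix.mul_nonsing_inv_cancel_left (H.map (algebraMap L (AdeleRing (𝓞 L) L))) (twistGram (adeleConj L) (H.map (algebraMap L (AdeleRing (𝓞 L) L))) _)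
      (isUnit_det_adelicForm hHd),
    ← p.adelicCartanGlue_adelicCartanRepr hH hHd hreg]
  rw [map_hermForm_of_comp (cmConjRingHom L) H (adeleConj L) (algebraMap L (AdeleRing (𝓞 L) L)) (fun r => (adeleConj_algebraMap L r).symm) v₀ v₀]
  unfold hermForm
  rw [← Matrix.mulVec_mulVec, adelicCartanGlue_mulVec_eq_smul π hπv, Matrix.mulVec_smul, dotProduct_smul, smul_eq_mul]

/-- **Changing the conjugator multiplies the `H`-value by an adelic NORM**: for any `g` with `g (γ₀ ⊗ 1) g⁻¹ = p`, `g = g(p) t` with `t ∈ Z(γ₀ ⊗ 1)`, `t (v₀ ⊗ 1) = c (v₀ ⊗ 1)`,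
so `⟨g(v₀⊗1), g(v₀⊗1)⟩ = c̄ · ⟨g(p)(v₀⊗1), g(p)(v₀⊗1)⟩ · c`, `c ∈ 𝔸_Lˣ`. [cite: Rogawski1990, §3.3 (3.3.1) p. 22] [cite: Kottwitz1986, §9] -/
theorem MatchingAdeleG₂.exists_hermForm_mulVec_eq_adeleConj_mul_mul (hreg : IsRegularElt ((γ₀ : unitaryGroup (cmConjRingHom L) H).val : GL (Fin 3) L))
    (p : MatchingAdeleG₂ L H H γ₀) (π : ↥(cartanSubalgebra γ₀) →ₐ[L] L) {v₀ : Fin 3 → L}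
    (hπv : ∀ b : ↥(cartanSubalgebra γ₀), (b : Matrix (Fin 3) (Fin 3) L) *ᵥ v₀ = π b • v₀) {g : GL (Fin 3) (AdeleRing (𝓞 L) L)}
    (hg : g * (((UnitaryGroup.cmDatum L 3 H).toAdelic γ₀).val : GL (Fin 3) (AdeleRing (𝓞 L) L)) * g⁻¹ = (p.adele.val : GL (Fin 3) (AdeleRing (𝓞 L) L))) :
    ∃ c : AdeleRing (𝓞 L) L, IsUnit c ∧
      hermForm (adeleConj L) (H.map (algebraMap L (AdeleRing (𝓞 L) L)))
          ((g : Matrix (Fin 3) (Fin 3) (AdeleRing (𝓞 L) L)) *ᵥ ((algebraMap L (AdeleRing (𝓞 L) L)) ∘ v₀))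
          ((g : Matrix (Fin 3) (Fin 3) (AdeleRing (𝓞 L) L)) *ᵥ ((algebraMap L (AdeleRing (𝓞 L) L)) ∘ v₀)) =
        adeleConj L c *
          hermForm (adeleConj L) (H.map (algebraMap L (AdeleRing (𝓞 L) L)))
            (((p.adelicConjugator hreg : GL (Fin 3) (AdeleRing (𝓞 L) L)) : Matrix (Fin 3) (Fin 3) (AdeleRing (𝓞 L) L)) *ᵥ ((algebraMap L (AdeleRing (𝓞 L) L)) ∘ v₀))
            (((p.adelicConjugator hreg : GL (Fin 3) (AdeleRing (𝓞 L) L)) : Matrix (Fin 3) (Fin 3) (AdeleRing (𝓞 L) L)) *ᵥ ((algebraMap L (AdeleRing (𝓞 L) L)) ∘ v₀)) * c := by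
  obtain ⟨t, ht, rfl⟩ := exists_commute_eq_mul_of_conj_eq (p.adelicConjugator_conj hreg) hg
  obtain ⟨c, hc, htv⟩ := exists_isUnit_mulVec_eq_smul_of_commute hreg π hπv t ht
  refine ⟨c, hc, ?_⟩
  rw [Units.val_mul, ← Matrix.mulVec_mulVec, htv, Matrix.mulVec_smul, hermForm_smul_smul_both]
  ring

/-- **THE OBSTRUCTION AT A DEGREE-ONE FACTOR, EIGENVECTOR FORM.**  Let `γ₀ ∈ U(H)(L⁺)` be regular (`H` hermitian invertible), `𝔪` a τ-stable simple factor of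
`L[γ₀]` of degree one — `γ₀ − u ∈ 𝔪` for the rational (necessarily unitary, `u·cu = 1`) eigenvalue `u` — and `γ₀ v₀ = u v₀`, `v₀ ∈ L³ ∖ 0`.  Then for EVERY adelic
conjugator `g` of a matching adèle `p ∈ 𝒞′_𝐀(γ₀)` (`g (γ₀ ⊗ 1) g⁻¹ = p`; `g (v₀ ⊗ 1)` is the `u`-eigenvector of `p`):
`(obs p)_𝔪 = 0 ⟺ ⟨g(v₀ ⊗ 1), g(v₀ ⊗ 1)⟩_{H ⊗ 1} ∈ 𝔸_L` is «GLOBAL `c`-FIXED × ADELIC NORM» (★ `IsPrincipalAdelicNorm`) — Kottwitz's `inv(γ₀, p)` at the factor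
`K_𝔪 = L`, `K_𝔪^τ = L⁺`, is the norm class of the `H`-value on the eigenvector [Prop. 3.5.2 (c): `H¹ ≅ ⊕_j K_j^{τ,×} ∕ N K_j^×`].
[cite: Rogawski1990, §3.5 Prop. 3.5.2 (c) p. 29; §3.3 (3.3.1) p. 22; §4.3 (4.3.3) p. 44] [cite: Kottwitz1986, §9] -/
theorem MatchingAdeleG₂.cartanObsFun_eq_zero_iff_isPrincipalAdelicNorm_hermForm (hH : (H.map (cmConjRingHom L))ᵀ = H) (hHd : IsUnit H.det)
    (hreg : IsRegularElt ((γ₀ : unitaryGroup (cmConjRingHom L) H).val : GL (Fin 3) L)) (p : MatchingAdeleG₂ L H H γ₀) (𝔪 : cartanIndexCM hH hHd hreg) {u : L}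
    (hu : (⟨(((γ₀ : unitaryGroup (cmConjRingHom L) H).val : GL (Fin 3) L) : Matrix (Fin 3) (Fin 3) L), Algebra.self_mem_adjoin_singleton L _⟩ : ↥(cartanSubalgebra γ₀)) -
      algebraMap L ↥(cartanSubalgebra γ₀) u ∈ 𝔪.1.asIdeal)
    {v₀ : Fin 3 → L} (hv₀ : (((γ₀ : unitaryGroup (cmConjRingHom L) H).val : GL (Fin 3) L) : Matrix (Fin 3) (Fin 3) L) *ᵥ v₀ = u • v₀) (hv₀0 : v₀ ≠ 0)
    {g : GL (Fin 3) (AdeleRing (𝓞 L) L)}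
    (hg : g * (((UnitaryGroup.cmDatum L 3 H).toAdelic γ₀).val : GL (Fin 3) (AdeleRing (𝓞 L) L)) * g⁻¹ = (p.adele.val : GL (Fin 3) (AdeleRing (𝓞 L) L))) :
    p.cartanObsFun hH hHd hreg 𝔪 = 0 ↔
      IsPrincipalAdelicNorm L (hermForm (adeleConj L) (H.map (algebraMap L (AdeleRing (𝓞 L) L)))
        ((g : Matrix (Fin 3) (Fin 3) (AdeleRing (𝓞 L) L)) *ᵥ ((algebraMap L (AdeleRing (𝓞 L) L)) ∘ v₀))
        ((g : Matrix (Fin 3) (Fin 3) (AdeleRing (𝓞 L) L)) *ᵥ ((algebraMap L (AdeleRing (𝓞 L) L)) ∘ v₀))) := by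
  obtain ⟨π, hker⟩ := exists_algHom_ker_eq_of_matrixGen_sub_algebraMap_mem 𝔪.1 hu
  have hπv : ∀ b : ↥(cartanSubalgebra γ₀), (b : Matrix (Fin 3) (Fin 3) L) *ᵥ v₀ = π b • v₀ := coe_mulVec_eq_smul_of_ker hker hu hv₀
  have hu1 : u * cmConjRingHom L u = 1 := mul_cmConj_eq_one_of_matrixGen_sub_algebraMap_mem hH hHd hreg 𝔪 hu
  have h₀ : hermForm (cmConjRingHom L) H v₀ v₀ ≠ 0 :=
    hermForm_self_ne_zero_of_mulVec_eq_smul (cmConjRingHom L) hHd (transpose_map_mul_mul_eq_of_rational γ₀) hreg hu1 hv₀ hv₀0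
  have h₀c : cmConjRingHom L (hermForm (cmConjRingHom L) H v₀ v₀) = hermForm (cmConjRingHom L) H v₀ v₀ :=
    map_hermForm_self (cmConjRingHom L) H (IsCMField.complexConj_apply_apply L) hH v₀
  obtain ⟨c, hc, hceq⟩ := p.exists_hermForm_mulVec_eq_adeleConj_mul_mul hreg π hπv hg
  rw [p.cartanObsFun_eq_zero_iff_isPrincipalAdelicNorm_map hH hHd hreg 𝔪 hu π hker, ← isPrincipalAdelicNorm_mul_algebraMap_iff h₀ h₀c,
    ← p.hermForm_adelicConjugator_mulVec_eq hH hHd hreg π hπv, hceq, isPrincipalAdelicNorm_adeleConj_mul_mul_iff hc]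

end Obstruction

/-! ## §6 Descent to an idèle of `L⁺` and the class-field-theory reading `(obs p)_𝔪 = [W]_{L⁺, θ}` -/

section Indicator

variable {L : Type} [Field L] [NumberField L] [IsCMField L] {H : Matrix (Fin 3) (Fin 3) L} {γ₀ : (UnitaryGroup.cmDatum L 3 H).Rational}

/-- **The `H`-value of the transported eigenvector DESCENDS to an idèle `W ∈ 𝕀_{L⁺}`** (`con W = ⟨g(v₀⊗1), g(v₀⊗1)⟩_{H⊗1}`): it is `c`-fixed (`H` hermitian) and an
adelic unit (`= c̄c · e((1⊗π)X_p) · (⟨v₀,v₀⟩_H ⊗ 1)` with `X_p` a unit and `⟨v₀, v₀⟩_H ≠ 0`, ★ `hermForm_self_ne_zero_of_mulVec_eq_smul`); Galois descent of idèles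
(★ `exists_ideleBaseChange_eq_of_adeleConj_eq`).  `W` is unique (★ `AdeleRing.ideleBaseChange_injective`). [cite: CasselsFrohlichANT1967, Ch. VII §7.3 (a)]
[cite: Rogawski1990, §3.5 Prop. 3.5.2 (c) p. 29] -/
theorem MatchingAdeleG₂.exists_ideleBaseChange_eq_hermForm (hH : (H.map (cmConjRingHom L))ᵀ = H) (hHd : IsUnit H.det)
    (hreg : IsRegularElt ((γ₀ : unitaryGroup (cmConjRingHom L) H).val : GL (Fin 3) L)) (p : MatchingAdeleG₂ L H H γ₀) (𝔪 : cartanIndexCM hH hHd hreg) {u : L}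
    (hu : (⟨(((γ₀ : unitaryGroup (cmConjRingHom L) H).val : GL (Fin 3) L) : Matrix (Fin 3) (Fin 3) L), Algebra.self_mem_adjoin_singleton L _⟩ : ↥(cartanSubalgebra γ₀)) -
      algebraMap L ↥(cartanSubalgebra γ₀) u ∈ 𝔪.1.asIdeal)
    {v₀ : Fin 3 → L} (hv₀ : (((γ₀ : unitaryGroup (cmConjRingHom L) H).val : GL (Fin 3) L) : Matrix (Fin 3) (Fin 3) L) *ᵥ v₀ = u • v₀) (hv₀0 : v₀ ≠ 0)
    {g : GL (Fin 3) (AdeleRing (𝓞 L) L)}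
    (hg : g * (((UnitaryGroup.cmDatum L 3 H).toAdelic γ₀).val : GL (Fin 3) (AdeleRing (𝓞 L) L)) * g⁻¹ = (p.adele.val : GL (Fin 3) (AdeleRing (𝓞 L) L))) :
    ∃ W : (AdeleRing (𝓞 ↥(maximalRealSubfield L)) ↥(maximalRealSubfield L))ˣ,
      ((AdeleRing.ideleBaseChange (↥(maximalRealSubfield L)) L W : (AdeleRing (𝓞 L) L)ˣ) : AdeleRing (𝓞 L) L) =
        hermForm (adeleConj L) (H.map (algebraMap L (AdeleRing (𝓞 L) L)))
          ((g : Matrix (Fin 3) (Fin 3) (AdeleRing (𝓞 L) L)) *ᵥ ((algebraMap L (AdeleRing (𝓞 L) L)) ∘ v₀))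
          ((g : Matrix (Fin 3) (Fin 3) (AdeleRing (𝓞 L) L)) *ᵥ ((algebraMap L (AdeleRing (𝓞 L) L)) ∘ v₀)) := by
  obtain ⟨π, hker⟩ := exists_algHom_ker_eq_of_matrixGen_sub_algebraMap_mem 𝔪.1 hu
  have hπv : ∀ b : ↥(cartanSubalgebra γ₀), (b : Matrix (Fin 3) (Fin 3) L) *ᵥ v₀ = π b • v₀ := coe_mulVec_eq_smul_of_ker hker hu hv₀
  have hu1 : u * cmConjRingHom L u = 1 := mul_cmConj_eq_one_of_matrixGen_sub_algebraMap_mem hH hHd hreg 𝔪 hu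
  have h₀ : hermForm (cmConjRingHom L) H v₀ v₀ ≠ 0 :=
    hermForm_self_ne_zero_of_mulVec_eq_smul (cmConjRingHom L) hHd (transpose_map_mul_mul_eq_of_rational γ₀) hreg hu1 hv₀ hv₀0
  obtain ⟨c, hc, hceq⟩ := p.exists_hermForm_mulVec_eq_adeleConj_mul_mul hreg π hπv hg
  refine exists_ideleBaseChange_eq_of_adeleConj_eq ?_
    (map_hermForm_self (adeleConj L) (H.map (algebraMap L (AdeleRing (𝓞 L) L))) (adeleConj_adeleConj L) (conjTranspose_adelicForm hH) _)
  rw [hceq, p.hermForm_adelicConjugator_mulVec_eq hH hHd hreg π hπv]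
  refine ((hc.map (adeleConj L)).mul (IsUnit.mul ?_ ((IsUnit.mk0 _ h₀).map _))).mul hc
  set X := p.adelicCartanRepr hH hHd hreg with hX
  refine IsUnit.of_mul_eq_one
    (adeleRingTensorAlgEquiv (↥(maximalRealSubfield L)) L
      (Algebra.TensorProduct.map (AlgHom.id (AdeleRing (𝓞 ↥(maximalRealSubfield L)) ↥(maximalRealSubfield L)) (AdeleRing (𝓞 ↥(maximalRealSubfield L)) ↥(maximalRealSubfield L)))
        (π.restrictScalars ↥(maximalRealSubfield L)) ((X⁻¹ : (adelicCartanAlgebra γ₀)ˣ) : adelicCartanAlgebra γ₀))) ?_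
  rw [← map_mul, ← map_mul, Units.mul_inv, map_one, map_one]

/-- **`(obs p)_𝔪 = [W]_{L⁺, θ}` — KOTTWITZ'S OBSTRUCTION AT THE DEGREE-ONE FACTOR IS THE QUADRATIC ARTIN SYMBOL OF `L ∕ L⁺` AT THE `H`-VALUE OF THE EIGENVECTOR.**
For `W ∈ 𝕀_{L⁺}` with `con W = ⟨g(v₀ ⊗ 1), g(v₀ ⊗ 1)⟩_{H ⊗ 1}` (it exists: `exists_ideleBaseChange_eq_hermForm`), `(obs p)_𝔪 = quadraticArtinIndicator L⁺ θ W`, `θ = cmQuadraticGenerator L`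
(`L = L⁺(√θ)`): `0 ↔` «global × norm» (`cartanObsFun_eq_zero_iff_isPrincipalAdelicNorm_hermForm`) `↔ W ∈ (L⁺)ˣ · N(𝕀_L)` (★ `isPrincipalAdelicNorm_iff_mem_sup`)
`= (L⁺)ˣ · normIdeles L⁺ θ` (★ O'Meara 65:2 `range_ideleRelNorm_maximalRealSubfield_eq`) `↔ [W] = 0`.  With `[W] = Σ_v (W_v, θ)_v` (★ `QuadraticArtinIndicator*`) this is the
finite-and-real-place sum the explicit transfer factor `Δ‴` reads through its `κ_v`'s [§4.3 (4.3.3)]. [cite: Rogawski1990, §3.5 Prop. 3.5.2 (c) p. 29; §4.3 (4.3.3) p. 44; §14.6 p. 242]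
[cite: Kottwitz1986, §9] [cite: Omeara1963, §65A Example 65:2] -/
theorem MatchingAdeleG₂.cartanObsFun_eq_quadraticArtinIndicator_hermForm (hH : (H.map (cmConjRingHom L))ᵀ = H) (hHd : IsUnit H.det)
    (hreg : IsRegularElt ((γ₀ : unitaryGroup (cmConjRingHom L) H).val : GL (Fin 3) L)) (p : MatchingAdeleG₂ L H H γ₀) (𝔪 : cartanIndexCM hH hHd hreg) {u : L}
    (hu : (⟨(((γ₀ : unitaryGroup (cmConjRingHom L) H).val : GL (Fin 3) L) : Matrix (Fin 3) (Fin 3) L), Algebra.self_mem_adjoin_singleton L _⟩ : ↥(cartanSubalgebra γ₀)) -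
      algebraMap L ↥(cartanSubalgebra γ₀) u ∈ 𝔪.1.asIdeal)
    {v₀ : Fin 3 → L} (hv₀ : (((γ₀ : unitaryGroup (cmConjRingHom L) H).val : GL (Fin 3) L) : Matrix (Fin 3) (Fin 3) L) *ᵥ v₀ = u • v₀) (hv₀0 : v₀ ≠ 0)
    {g : GL (Fin 3) (AdeleRing (𝓞 L) L)}
    (hg : g * (((UnitaryGroup.cmDatum L 3 H).toAdelic γ₀).val : GL (Fin 3) (AdeleRing (𝓞 L) L)) * g⁻¹ = (p.adele.val : GL (Fin 3) (AdeleRing (𝓞 L) L)))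
    (W : (AdeleRing (𝓞 ↥(maximalRealSubfield L)) ↥(maximalRealSubfield L))ˣ)
    (hW : ((AdeleRing.ideleBaseChange (↥(maximalRealSubfield L)) L W : (AdeleRing (𝓞 L) L)ˣ) : AdeleRing (𝓞 L) L) =
      hermForm (adeleConj L) (H.map (algebraMap L (AdeleRing (𝓞 L) L)))
        ((g : Matrix (Fin 3) (Fin 3) (AdeleRing (𝓞 L) L)) *ᵥ ((algebraMap L (AdeleRing (𝓞 L) L)) ∘ v₀))
        ((g : Matrix (Fin 3) (Fin 3) (AdeleRing (𝓞 L) L)) *ᵥ ((algebraMap L (AdeleRing (𝓞 L) L)) ∘ v₀))) :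
    p.cartanObsFun hH hHd hreg 𝔪 = quadraticArtinIndicator (↥(maximalRealSubfield L)) (cmQuadraticGenerator L : ↥(maximalRealSubfield L)) W := by
  have hiff : p.cartanObsFun hH hHd hreg 𝔪 = 0 ↔
      quadraticArtinIndicator (↥(maximalRealSubfield L)) (cmQuadraticGenerator L : ↥(maximalRealSubfield L)) W = 0 := by
    rw [p.cartanObsFun_eq_zero_iff_isPrincipalAdelicNorm_hermForm hH hHd hreg 𝔪 hu hv₀ hv₀0 hg, isPrincipalAdelicNorm_iff_mem_sup W hW,
      quadraticArtinIndicator_eq_zero_iff, ← range_ideleRelNorm_maximalRealSubfield_eq]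
  rcases p.cartanObsFun_eq_zero_or_eq_one hH hHd hreg 𝔪 with h0 | h1
  · rw [h0]; exact (hiff.1 h0).symm
  · rw [h1]
    by_cases h0' : quadraticArtinIndicator (↥(maximalRealSubfield L)) (cmQuadraticGenerator L : ↥(maximalRealSubfield L)) W = 0
    · exact absurd (hiff.2 h0') (by rw [h1]; exact one_ne_zero)
    · exact (quadraticArtinIndicator_eq_one_iff.2 (fun hmem => h0' (quadraticArtinIndicator_eq_zero_iff.2 hmem))).symm

/-- **`(obs p)_𝔪 = 0 ⟺ W = (k) · N_{L∕L⁺}(Z)`** for a global `k ∈ L⁺ˣ` and an idèle `Z` of `L` (★ `quadraticArtinIndicator_eq_zero_iff_exists_ideleRelNorm`, O'Meara 65:2).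
[cite: Rogawski1990, §3.5 Prop. 3.5.2 (c) p. 29] [cite: Omeara1963, §65A Example 65:2] [cite: CasselsFrohlichANT1967, Ch. VII §5.1 (B)] -/
theorem MatchingAdeleG₂.cartanObsFun_eq_zero_iff_exists_ideleRelNorm_hermForm (hH : (H.map (cmConjRingHom L))ᵀ = H) (hHd : IsUnit H.det)
    (hreg : IsRegularElt ((γ₀ : unitaryGroup (cmConjRingHom L) H).val : GL (Fin 3) L)) (p : MatchingAdeleG₂ L H H γ₀) (𝔪 : cartanIndexCM hH hHd hreg) {u : L}
    (hu : (⟨(((γ₀ : unitaryGroup (cmConjRingHom L) H).val : GL (Fin 3) L) : Matrix (Fin 3) (Fin 3) L), Algebra.self_mem_adjoin_singleton L _⟩ : ↥(cartanSubalgebra γ₀)) -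
      algebraMap L ↥(cartanSubalgebra γ₀) u ∈ 𝔪.1.asIdeal)
    {v₀ : Fin 3 → L} (hv₀ : (((γ₀ : unitaryGroup (cmConjRingHom L) H).val : GL (Fin 3) L) : Matrix (Fin 3) (Fin 3) L) *ᵥ v₀ = u • v₀) (hv₀0 : v₀ ≠ 0)
    {g : GL (Fin 3) (AdeleRing (𝓞 L) L)}
    (hg : g * (((UnitaryGroup.cmDatum L 3 H).toAdelic γ₀).val : GL (Fin 3) (AdeleRing (𝓞 L) L)) * g⁻¹ = (p.adele.val : GL (Fin 3) (AdeleRing (𝓞 L) L)))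
    (W : (AdeleRing (𝓞 ↥(maximalRealSubfield L)) ↥(maximalRealSubfield L))ˣ)
    (hW : ((AdeleRing.ideleBaseChange (↥(maximalRealSubfield L)) L W : (AdeleRing (𝓞 L) L)ˣ) : AdeleRing (𝓞 L) L) =
      hermForm (adeleConj L) (H.map (algebraMap L (AdeleRing (𝓞 L) L)))
        ((g : Matrix (Fin 3) (Fin 3) (AdeleRing (𝓞 L) L)) *ᵥ ((algebraMap L (AdeleRing (𝓞 L) L)) ∘ v₀))
        ((g : Matrix (Fin 3) (Fin 3) (AdeleRing (𝓞 L) L)) *ᵥ ((algebraMap L (AdeleRing (𝓞 L) L)) ∘ v₀))) :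
    p.cartanObsFun hH hHd hreg 𝔪 = 0 ↔
      ∃ (k : (↥(maximalRealSubfield L))ˣ) (Z : (AdeleRing (𝓞 L) L)ˣ),
        W = Units.map (algebraMap (↥(maximalRealSubfield L)) (AdeleRing (𝓞 ↥(maximalRealSubfield L)) ↥(maximalRealSubfield L)) :
          ↥(maximalRealSubfield L) →* AdeleRing (𝓞 ↥(maximalRealSubfield L)) ↥(maximalRealSubfield L)) k *
          AdeleRing.ideleRelNorm (↥(maximalRealSubfield L)) L Z := by
  obtain ⟨α, hα0, hcα, hsq⟩ := cmQuadraticGenerator_spec L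
  rw [p.cartanObsFun_eq_quadraticArtinIndicator_hermForm hH hHd hreg 𝔪 hu hv₀ hv₀0 hg W hW]
  exact quadraticArtinIndicator_eq_zero_iff_exists_ideleRelNorm (IsCMField.complexConj L) hcα hα0 (by rw [← sq]; exact hsq) W

/-- **PLACEWISE reading: `(obs p)_𝔪 = 0 ⟺ W ∈ (L⁺)ˣ · normIdeles L⁺ θ`** — a global element times an idèle that is a LOCAL NORM from `L⁺_v(√θ)` at every place;
through ★ `quadraticArtinIndicator` = `Σ_v` of local norm-residue symbols (Hilbert reciprocity on the global factor) this is the «`∏_{v ≤ ∞} (x_v, θ)_v`» of (4.3.3).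
[cite: Omeara1963, §65A Example 65:2] [cite: Rogawski1990, §4.3 (4.3.3) p. 44; §14.6 p. 242] -/
theorem MatchingAdeleG₂.cartanObsFun_eq_zero_iff_mem_sup_normIdeles_hermForm (hH : (H.map (cmConjRingHom L))ᵀ = H) (hHd : IsUnit H.det)
    (hreg : IsRegularElt ((γ₀ : unitaryGroup (cmConjRingHom L) H).val : GL (Fin 3) L)) (p : MatchingAdeleG₂ L H H γ₀) (𝔪 : cartanIndexCM hH hHd hreg) {u : L}
    (hu : (⟨(((γ₀ : unitaryGroup (cmConjRingHom L) H).val : GL (Fin 3) L) : Matrix (Fin 3) (Fin 3) L), Algebra.self_mem_adjoin_singleton L _⟩ : ↥(cartanSubalgebra γ₀)) -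
      algebraMap L ↥(cartanSubalgebra γ₀) u ∈ 𝔪.1.asIdeal)
    {v₀ : Fin 3 → L} (hv₀ : (((γ₀ : unitaryGroup (cmConjRingHom L) H).val : GL (Fin 3) L) : Matrix (Fin 3) (Fin 3) L) *ᵥ v₀ = u • v₀) (hv₀0 : v₀ ≠ 0)
    {g : GL (Fin 3) (AdeleRing (𝓞 L) L)}
    (hg : g * (((UnitaryGroup.cmDatum L 3 H).toAdelic γ₀).val : GL (Fin 3) (AdeleRing (𝓞 L) L)) * g⁻¹ = (p.adele.val : GL (Fin 3) (AdeleRing (𝓞 L) L)))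
    (W : (AdeleRing (𝓞 ↥(maximalRealSubfield L)) ↥(maximalRealSubfield L))ˣ)
    (hW : ((AdeleRing.ideleBaseChange (↥(maximalRealSubfield L)) L W : (AdeleRing (𝓞 L) L)ˣ) : AdeleRing (𝓞 L) L) =
      hermForm (adeleConj L) (H.map (algebraMap L (AdeleRing (𝓞 L) L)))
        ((g : Matrix (Fin 3) (Fin 3) (AdeleRing (𝓞 L) L)) *ᵥ ((algebraMap L (AdeleRing (𝓞 L) L)) ∘ v₀))
        ((g : Matrix (Fin 3) (Fin 3) (AdeleRing (𝓞 L) L)) *ᵥ ((algebraMap L (AdeleRing (𝓞 L) L)) ∘ v₀))) :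
    p.cartanObsFun hH hHd hreg 𝔪 = 0 ↔
      W ∈ principalIdeles ↥(maximalRealSubfield L) ⊔
        Literature.NumberTheory.QuadraticForms.normIdeles ↥(maximalRealSubfield L) (cmQuadraticGenerator L : ↥(maximalRealSubfield L)) := by
  rw [p.cartanObsFun_eq_quadraticArtinIndicator_hermForm hH hHd hreg 𝔪 hu hv₀ hv₀0 hg W hW, quadraticArtinIndicator_eq_zero_iff]

/-- **The class-weight sign `(−1)^{(obs p)_𝔪}` of the pre-stabilised count (5.4.2)–(5.4.5) as a quadratic Artin sign**: `(−1)^{(obs p)_𝔪} = (−1)^{[W]_{L⁺,θ}}`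
— the form in which ★ `GlobalKappaFormula … (cartanObs ∘ toSelf) (e 𝒪H)` (pin `e(𝒪H)(ε) = (−1)^{ε(s 𝒪H)}`) meets the product `∏_{v ≤ ∞} κ_v` of the explicit transfer
factors. [cite: Rogawski1990, §4.3 (4.3.3) p. 44; §5.4 (5.4.5) p. 73; §14.6 p. 242] -/
theorem MatchingAdeleG₂.neg_one_pow_cartanObsFun_eq_neg_one_pow_quadraticArtinIndicator (hH : (H.map (cmConjRingHom L))ᵀ = H) (hHd : IsUnit H.det)
    (hreg : IsRegularElt ((γ₀ : unitaryGroup (cmConjRingHom L) H).val : GL (Fin 3) L)) (p : MatchingAdeleG₂ L H H γ₀) (𝔪 : cartanIndexCM hH hHd hreg) {u : L}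
    (hu : (⟨(((γ₀ : unitaryGroup (cmConjRingHom L) H).val : GL (Fin 3) L) : Matrix (Fin 3) (Fin 3) L), Algebra.self_mem_adjoin_singleton L _⟩ : ↥(cartanSubalgebra γ₀)) -
      algebraMap L ↥(cartanSubalgebra γ₀) u ∈ 𝔪.1.asIdeal)
    {v₀ : Fin 3 → L} (hv₀ : (((γ₀ : unitaryGroup (cmConjRingHom L) H).val : GL (Fin 3) L) : Matrix (Fin 3) (Fin 3) L) *ᵥ v₀ = u • v₀) (hv₀0 : v₀ ≠ 0)
    {g : GL (Fin 3) (AdeleRing (𝓞 L) L)}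
    (hg : g * (((UnitaryGroup.cmDatum L 3 H).toAdelic γ₀).val : GL (Fin 3) (AdeleRing (𝓞 L) L)) * g⁻¹ = (p.adele.val : GL (Fin 3) (AdeleRing (𝓞 L) L)))
    (W : (AdeleRing (𝓞 ↥(maximalRealSubfield L)) ↥(maximalRealSubfield L))ˣ)
    (hW : ((AdeleRing.ideleBaseChange (↥(maximalRealSubfield L)) L W : (AdeleRing (𝓞 L) L)ˣ) : AdeleRing (𝓞 L) L) =
      hermForm (adeleConj L) (H.map (algebraMap L (AdeleRing (𝓞 L) L)))
        ((g : Matrix (Fin 3) (Fin 3) (AdeleRing (𝓞 L) L)) *ᵥ ((algebraMap L (AdeleRing (𝓞 L) L)) ∘ v₀))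
        ((g : Matrix (Fin 3) (Fin 3) (AdeleRing (𝓞 L) L)) *ᵥ ((algebraMap L (AdeleRing (𝓞 L) L)) ∘ v₀))) :
    (-1 : ℂ) ^ (p.cartanObsFun hH hHd hreg 𝔪).val =
      (-1 : ℂ) ^ (quadraticArtinIndicator (↥(maximalRealSubfield L)) (cmQuadraticGenerator L : ↥(maximalRealSubfield L)) W).val := by
  rw [p.cartanObsFun_eq_quadraticArtinIndicator_hermForm hH hHd hreg 𝔪 hu hv₀ hv₀0 hg W hW]

end Indicator




end Literature.NumberTheory.Rogawski1990

end
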